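import Summits.MatrixMultiplication.MatrixMultiplication.Theorems.AbelianSTPPCensusTALin1700Rows
import Summits.MatrixMultiplication.MatrixMultiplication.Theorems.AbelianSTPPSieveVP
import Summits.MatrixMultiplication.MatrixMultiplication.Theorems.AbelianSTPPCensusTALin1200Sound

/-!
# T_A/1700 certificate: soundness of the linear one-pass checker (part 2; verbatim T_A/1200)

Cell mm-stpp (rung F-M1), T_A/1700 (VERBATIM `AbelianSTPPCensusTALin1200Sound.lean`, p509465, in the namespace `TALin1700`); design in `AbelianSTPPCensusTALin1200Defs.lean` /
`…TALin1700Defs.lean`; enumeration / invariant / loop lemmas in `AbelianSTPPCensusTALin1700Rows.lean`.  Proofs only: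
* **`budget_form`, `grynkiewicz_budget_A/B/C`** — the one new inequality: for a `SieveAdmissible ∧ U11G` shape list and a member `l` whose letter
  `a` (resp. `b`, `c`) is its smallest size, with `t = (that size)·(the smaller of the other two) ≥ 3`:
  `t·Σ_i (a_i b_i + b_i c_i + c_i a_i) + 1 ≤ Σ_i V_i + t·M + 2t²` ([Gry10] Thm 1.1 (6) — tree rule `U11GFormB` — in the letter form whose middle
  letter is `l`'s smallest size: the fibre budget `L(t) ≥ t` and the two pair sums `≥ t` are witnessed by `l` alone, the ceiling is
  `Σ y z·min(t,x) ≤ Σ V` (`ubB_le`), and `P₃ ≤ M` by U2);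
* `exists_sorted`: a candidate shape has a sorted candidate form with the same volume / pair-product sum / size sum whose first two entries are the
  smallest size and the smaller of the other two;
* `sum_gain_le`: for a shape list with `≥ 2` members that is `SieveAdmissible M` and `U11G M` at an order `M` of the range, all of whose volumes are
  `Checked`: `Σ_i gainOf2371w(V_i) ≤ 10⁶·M` (maximal member `l`, its sorted form is a checked candidate; case `passVP`: the Grynkiewicz budget and the
  U11-G density of the state; case `passVM`: the U11/U14 budget `cap` and the vM density);
* `not_beats_of_checked`: hence `¬ Beats (2371/1000) M` (`ShapeCert.rpow_le_gain2371w`).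
WHAT THIS IS NOT: no statement about STPP families beyond the consequences `SieveAdmissible` (vM) and `U11G` (U11-G); no bound on `ω`.
-/

set_option linter.dupNamespace false
set_option autoImplicit false

namespace Summit.MatrixMultiplication.MatrixMultiplication.Theorems.TALin1700

open TECert (tableOK vol us tableOK_iff tableOK_mono)
open ShapeCert (gainOf2371w D)

/-! ## The Grynkiewicz budget of a member: `TALin1200.budget_form`, `TALin1200.grynkiewicz_budget_A/B/C` (`AbelianSTPPCensusTALin1200Sound.lean`, imported) -/

/-! ## A sorted form of a candidate shape -/

/-- Every candidate shape `(a,b,c)` has a sorted candidate form `y` (`y.1 ≤ y.2.1 ≤ y.2.2`) with the same volume, pair-product sum and size sum,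
whose first two entries are the smallest size and the smaller of the other two, in one of the three letter positions. [bookkeeping] -/
theorem exists_sorted (a b c : ℕ) (h : TALin1700.Cand (a, b, c)) :
    ∃ y : ℕ × ℕ × ℕ, TALin1700.Cand y ∧ TALin1700.srt y = true ∧ vol y = a * b * c ∧ us y = a * b + b * c + c * a ∧
      y.1 + y.2.1 + y.2.2 = a + b + c ∧
      ((y.1 = a ∧ y.2.1 = min c b ∧ a ≤ c ∧ a ≤ b) ∨ (y.1 = b ∧ y.2.1 = min a c ∧ b ≤ a ∧ b ≤ c) ∨
        (y.1 = c ∧ y.2.1 = min b a ∧ c ≤ b ∧ c ≤ a)) := by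
  obtain ⟨ha, hb, hc, ht⟩ := h
  simp only at ha hb hc ht
  rcases le_total a b with hab | hab <;> rcases le_total b c with hbc | hbc <;> rcases le_total a c with hac | hac
  · -- a ≤ b ≤ c
    exact ⟨(a, b, c), ⟨ha, hb, hc, ht⟩, by simp [srt, hab, hbc], rfl, rfl, rfl,
      Or.inl ⟨rfl, by show b = min c b; rw [min_eq_right hbc], hac, hab⟩⟩
  · -- a ≤ b ≤ c ≤ a (all equal)
    exact ⟨(a, b, c), ⟨ha, hb, hc, ht⟩, by simp [srt, hab, hbc], rfl, rfl, rfl,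
      Or.inl ⟨rfl, by show b = min c b; rw [min_eq_right hbc], le_trans hab hbc, hab⟩⟩
  · -- a ≤ c ≤ b
    exact ⟨(a, c, b), ⟨ha, hc, hb, TALin1200.tableOK_swap23 ht⟩, by simp [srt, hac, hbc], by show a * c * b = a * b * c; ring,
      by show a * c + c * b + b * a = a * b + b * c + c * a; ring, by show a + c + b = a + b + c; ring,
      Or.inl ⟨rfl, by show c = min c b; rw [min_eq_left hbc], hac, hab⟩⟩
  · -- c ≤ a ≤ b
    exact ⟨(c, a, b), ⟨hc, ha, hb, TALin1200.tableOK_swap23 (TALin1200.tableOK_swap13 ht)⟩, by simp [srt, hac, hab], by show c * a * b = a * b * c; ring,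
      by show c * a + a * b + b * c = a * b + b * c + c * a; ring, by show c + a + b = a + b + c; ring,
      Or.inr (Or.inr ⟨rfl, by show a = min b a; rw [min_eq_right hab], le_trans hac hab, hac⟩)⟩
  · -- b ≤ a ≤ c
    exact ⟨(b, a, c), ⟨hb, ha, hc, TALin1200.tableOK_swap12 ht⟩, by simp [srt, hab, hac], by show b * a * c = a * b * c; ring,
      by show b * a + a * c + c * b = a * b + b * c + c * a; ring, by show b + a + c = a + b + c; ring,
      Or.inr (Or.inl ⟨rfl, by show a = min a c; rw [min_eq_left hac], hab, hbc⟩)⟩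
  · -- b ≤ c ≤ a
    exact ⟨(b, c, a), ⟨hb, hc, ha, TALin1200.tableOK_swap23 (TALin1200.tableOK_swap12 ht)⟩, by simp [srt, hbc, hac], by show b * c * a = a * b * c; ring,
      by show b * c + c * a + a * b = a * b + b * c + c * a; ring, by show b + c + a = a + b + c; ring,
      Or.inr (Or.inl ⟨rfl, by show c = min a c; rw [min_eq_right hac], hab, hbc⟩)⟩
  · -- c ≤ b ≤ a ≤ c (all equal)
    exact ⟨(c, b, a), ⟨hc, hb, ha, TALin1200.tableOK_swap13 ht⟩, by simp [srt, hbc, hab], by show c * b * a = a * b * c; ring,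
      by show c * b + b * a + a * c = a * b + b * c + c * a; ring, by show c + b + a = a + b + c; ring,
      Or.inr (Or.inr ⟨rfl, by show b = min b a; rw [min_eq_left hab], hbc, le_trans hbc hab⟩)⟩
  · -- c ≤ b ≤ a
    exact ⟨(c, b, a), ⟨hc, hb, ha, TALin1200.tableOK_swap13 ht⟩, by simp [srt, hbc, hab], by show c * b * a = a * b * c; ring,
      by show c * b + b * a + a * c = a * b + b * c + c * a; ring, by show c + b + a = a + b + c; ring,
      Or.inr (Or.inr ⟨rfl, by show b = min b a; rw [min_eq_left hab], hbc, hac⟩)⟩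

/-! ## From the certificate to shape lists -/

/-- **Arithmetic core.** If every volume `1 … Mtop` is `Checked` for the orders `lo … lo+n−1`, then every shape list that is `SieveAdmissible M`
and `U11G M`, with at least two members, at such an order `M ≤ Mtop`, has `Σ_i gainOf2371w (a_i b_i c_i) ≤ 10⁶ · M`. [original] -/
theorem sum_gain_le {lo n : ℕ} (hall : ∀ V, 1 ≤ V → V ≤ TALin1700.Mtop → TALin1700.Checked lo n V) {N M : ℕ}
    {a b c : Fin N → ℕ} (hN : 2 ≤ N) (hlo : lo ≤ M) (hhi : M < lo + n) (hM : M ≤ TALin1700.Mtop)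
    (hS : SieveAdmissible M a b c) (hG : U11G M a b c) :
    ∑ i, gainOf2371w (a i * b i * c i) ≤ D * M := by
  classical
  have hS' := hS
  obtain ⟨h1, h2, -, h4, h5, h6, -⟩ := hS
  haveI : Nontrivial (Fin N) := Fin.nontrivial_iff_two_le.mpr hN
  -- every member is a candidate (table at order `M ≤ Mtop`)
  have hcand : ∀ i, Cand (a i, b i, c i) := by
    intro i
    obtain ⟨ha, hb, hc, hV⟩ := h1 i
    obtain ⟨n1, n2, n3⟩ := h2 i
    obtain ⟨j, hj⟩ := exists_ne i
    obtain ⟨u1, u2, u3, -⟩ := h5 i j hj.symm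
    refine ⟨ha, hb, hc, tableOK_mono ((tableOK_iff _ _ _ _).mpr ⟨?_, n1, n2, n3, ?_, ?_, ?_⟩) hM⟩ <;>
      simp only [shapeVol] at hV u1 u2 u3 ⊢ <;> omega
  -- the member of maximal volume
  obtain ⟨l, -, hl⟩ := Finset.exists_max_image Finset.univ (fun i => a i * b i * c i)
    ⟨⟨0, by omega⟩, Finset.mem_univ _⟩
  set Vl := a l * b l * c l with hVl
  have hVl1 : 1 ≤ Vl := (cand_bounds (hcand l)).2
  have hVlM : Vl ≤ M := by have := (h1 l).2.2.2; simpa [shapeVol] using this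
  -- its sorted form
  obtain ⟨y, hyc, hys, hyv, hyu, hysum, hyt⟩ := exists_sorted (a l) (b l) (c l) (hcand l)
  have hmem : y ∈ triples Vl := by rw [hVl, ← hyv]; exact mem_triples_of_cand hyc
  have hne : triples Vl ≠ [] := fun h => by rw [h] at hmem; simp at hmem
  obtain ⟨s, hInv, hchk⟩ := hall Vl hVl1 (hVlM.trans hM) hne
  have hc := hchk M hlo hhi y hmem
  obtain ⟨hp1, hdom, hlen, hW⟩ := hInv
  -- every other member is dominated by the state
  have hcov : ∀ j, Cand (a j, b j, c j) ∧ vol (a j, b j, c j) ≤ Vl := fun j => ⟨hcand j, hl j (Finset.mem_univ j)⟩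
  -- unfold the check: sorted, so `passVP ∨ passVM`
  have hc' : passVP M (vol y) (gainOf2371w (vol y)) (us y) (y.1 * y.2.1) (s.2.2.getD (y.1 * y.2.1) (0, 1, false)) = true ∨
      passVM M (vol y) (gainOf2371w (vol y)) (2 * us y - (y.1 + y.2.1 + y.2.2)) s = true := by
    have := hc
    simp only [checkShape, hys, Bool.not_true, Bool.false_or, Bool.or_eq_true] at this
    exact this
  rw [hyv, hyu, hysum] at hc'
  -- common facts: split off the maximal member
  have esplit : ∀ f : Fin N → ℕ, ∑ j, f j = f l + ∑ j ∈ Finset.univ.erase l, f j :=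
    fun f => (Finset.add_sum_erase _ _ (Finset.mem_univ l)).symm
  set p : Fin N → ℕ := fun j => a j * b j + b j * c j + c j * a j with hp
  have hpl : p l = a l * b l + b l * c l + c l * a l := rfl
  rcases hc' with hvp | hvm
  · ---------------------------------------------------------------- case vP
    set t := y.1 * y.2.1 with htdef
    set e := s.2.2.getD t (0, 1, false) with he
    simp only [passVP, Bool.and_eq_true, Nat.ble_eq] at hvp
    obtain ⟨⟨⟨ht3, hok⟩, hVtp⟩, hineq⟩ := hvp
    -- `t ≤ Tmax` (else the default entry is invalid)
    have htT : t ≤ Tmax := by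
      by_contra hgt
      have : e = (0, 1, false) := by
        rw [he, List.getD_eq_default]; rw [hlen]; omega
      rw [this] at hok; exact absurd hok (by simp)
    obtain ⟨hw1, hWx⟩ := hW t htT hok
    -- the Grynkiewicz budget at `t`
    have hbud : t * (∑ i, p i) + 1 ≤ (∑ i, a i * b i * c i) + t * M + 2 * t ^ 2 := by
      rcases hyt with ⟨hy1, hy2, hm1, hm2⟩ | ⟨hy1, hy2, hm1, hm2⟩ | ⟨hy1, hy2, hm1, hm2⟩
      · exact TALin1200.grynkiewicz_budget_A hS' hG l ⟨hm1, hm2⟩ (by rw [htdef, hy1, hy2]) ht3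
      · exact TALin1200.grynkiewicz_budget_B hS' hG l ⟨hm1, hm2⟩ (by rw [htdef, hy1, hy2]) ht3
      · exact TALin1200.grynkiewicz_budget_C hS' hG l ⟨hm1, hm2⟩ (by rw [htdef, hy1, hy2]) ht3
    -- the others: weights positive, gains dominated
    have hwj : ∀ j, a j * b j * c j < t * p j ∧ gainOf2371w (a j * b j * c j) * e.2.1 ≤ e.1 * (t * p j - a j * b j * c j) := by
      intro j
      have hx := hWx (a j, b j, c j) (hcov j).1 (hcov j).2
      rw [← he] at hx
      simp only [vol, us, TECert.uu, TECert.vv, TECert.ww] at hx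
      exact hx
    -- sum of the others' weights within the budget
    have hsumw : e.1 * (∑ j ∈ Finset.univ.erase l, (t * p j - a j * b j * c j)) ≤
        e.1 * ((t * M + 2 * t * t - 1) - (t * (a l * b l + b l * c l + c l * a l) - Vl)) := by
      refine Nat.mul_le_mul_left _ ?_
      have eW : (∑ j ∈ Finset.univ.erase l, (t * p j - a j * b j * c j)) + ∑ j ∈ Finset.univ.erase l, a j * b j * c j =
          ∑ j ∈ Finset.univ.erase l, t * p j := by
        rw [← Finset.sum_add_distrib]
        exact Finset.sum_congr rfl fun j _ => Nat.sub_add_cancel (hwj j).1.le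
      have eT : ∑ j ∈ Finset.univ.erase l, t * p j = t * ∑ j ∈ Finset.univ.erase l, p j := (Finset.mul_sum _ _ _).symm
      have s1 := esplit p
      have s2 := esplit (fun j => a j * b j * c j)
      rw [← hVl] at s2
      -- one other member exists, with positive weight
      obtain ⟨j0, hj0⟩ := exists_ne l
      have hpos : 1 ≤ ∑ j ∈ Finset.univ.erase l, (t * p j - a j * b j * c j) := by
        calc 1 ≤ t * p j0 - a j0 * b j0 * c j0 := by have := (hwj j0).1; omega
          _ ≤ ∑ j ∈ Finset.univ.erase l, (t * p j - a j * b j * c j) :=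
            Finset.single_le_sum (f := fun j => t * p j - a j * b j * c j) (fun j _ => Nat.zero_le _)
              (Finset.mem_erase.2 ⟨hj0, Finset.mem_univ _⟩)
      generalize hA : ∑ j ∈ Finset.univ.erase l, (t * p j - a j * b j * c j) = A at *
      generalize hB : ∑ j ∈ Finset.univ.erase l, a j * b j * c j = B at *
      generalize hC : ∑ j ∈ Finset.univ.erase l, p j = C at *
      generalize hTM : t * M = TM at *
      generalize hTp : t * p l = Tp at *
      generalize hTC : t * C = TC at *
      have e3 : t * (p l + C) = Tp + TC := by rw [← hTp, ← hTC]; ring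
      have e4 : 2 * t ^ 2 = 2 * t * t := by ring
      rw [hpl] at hTp
      rw [s1, s2, e3, e4] at hbud
      omega
    -- the others' gains
    have hsumg : (∑ j ∈ Finset.univ.erase l, gainOf2371w (a j * b j * c j)) * e.2.1 ≤
        e.1 * ∑ j ∈ Finset.univ.erase l, (t * p j - a j * b j * c j) := by
      rw [Finset.sum_mul, Finset.mul_sum]
      exact Finset.sum_le_sum fun j _ => (hwj j).2
    rw [esplit (fun j => gainOf2371w (a j * b j * c j))]
    have key : (gainOf2371w Vl + ∑ j ∈ Finset.univ.erase l, gainOf2371w (a j * b j * c j)) * e.2.1 ≤ D * M * e.2.1 := by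
      rw [Nat.add_mul]
      calc gainOf2371w Vl * e.2.1 + (∑ j ∈ Finset.univ.erase l, gainOf2371w (a j * b j * c j)) * e.2.1
          ≤ gainOf2371w Vl * e.2.1 + e.1 * ((t * M + 2 * t * t - 1) - (t * (a l * b l + b l * c l + c l * a l) - Vl)) :=
            Nat.add_le_add_left (hsumg.trans hsumw) _
        _ = gainOf2371w Vl * e.2.1 + ((t * M + 2 * t * t - 1) - (t * (a l * b l + b l * c l + c l * a l) - Vl)) * e.1 := by ring
        _ ≤ D * M * e.2.1 := hineq
    rw [← hVl]
    exact Nat.le_of_mul_le_mul_right key hw1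
  · ---------------------------------------------------------------- case vM
    simp only [passVM, Nat.ble_eq] at hvm
    -- budget (i): the three U11 rows at `l`
    obtain ⟨hA, hB, hC⟩ := h4 l
    have e2 : (∑ j, a j * (b j + c j)) + (∑ j, b j * (c j + a j)) + ∑ j, c j * (a j + b j) = 2 * ∑ j, p j := by
      rw [Finset.mul_sum, ← Finset.sum_add_distrib, ← Finset.sum_add_distrib]
      exact Finset.sum_congr rfl fun j _ => by simp only [hp]; ring
    have hdd : a l + b l + c l ≤ 2 * p l := by
      have := (cand_bounds (hcand l)).1
      simp only [us, TECert.uu, TECert.vv, TECert.ww, hpl] at this ⊢; nlinarith [(hcand l).1, (hcand l).2.1, (hcand l).2.2.1]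
    have hsum1 : 2 * ∑ j ∈ Finset.univ.erase l, p j ≤ 3 * M - (2 * p l - (a l + b l + c l)) := by
      have s1 := esplit p; omega
    -- budget (ii): the three U14 rows at `l`
    obtain ⟨hab, -, hbc, -, hca, -⟩ := h6 l
    simp only [u14Sum, shapeVol] at hab hbc hca
    have hsum2 : ∑ j ∈ Finset.univ.erase l, p j ≤ 3 * (M - Vl) := by
      have : ∑ j ∈ Finset.univ.erase l, p j = (∑ j ∈ Finset.univ.erase l, a j * b j) +
          (∑ j ∈ Finset.univ.erase l, b j * c j) + ∑ j ∈ Finset.univ.erase l, c j * a j := by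
        rw [← Finset.sum_add_distrib, ← Finset.sum_add_distrib]
      rw [this]; omega
    have hcap : ∑ j ∈ Finset.univ.erase l, p j ≤ cap M Vl (2 * p l - (a l + b l + c l)) := by
      simp only [cap]; omega
    -- the others' gains
    have hsumg : (∑ j ∈ Finset.univ.erase l, gainOf2371w (a j * b j * c j)) * s.2.1 ≤ s.1 * ∑ j ∈ Finset.univ.erase l, p j := by
      rw [Finset.sum_mul, Finset.mul_sum]
      refine Finset.sum_le_sum fun j _ => ?_
      have hx := hdom (a j, b j, c j) (hcov j).1 (hcov j).2
      simp only [vol, us, TECert.uu, TECert.vv, TECert.ww] at hx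
      exact hx
    rw [esplit (fun j => gainOf2371w (a j * b j * c j))]
    have key : (gainOf2371w Vl + ∑ j ∈ Finset.univ.erase l, gainOf2371w (a j * b j * c j)) * s.2.1 ≤ D * M * s.2.1 := by
      rw [Nat.add_mul]
      calc gainOf2371w Vl * s.2.1 + (∑ j ∈ Finset.univ.erase l, gainOf2371w (a j * b j * c j)) * s.2.1
          ≤ gainOf2371w Vl * s.2.1 + s.1 * cap M Vl (2 * p l - (a l + b l + c l)) :=
            Nat.add_le_add_left (hsumg.trans (Nat.mul_le_mul_left _ hcap)) _
        _ = gainOf2371w Vl * s.2.1 + cap M Vl (2 * p l - (a l + b l + c l)) * s.1 := by ring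
        _ ≤ D * M * s.2.1 := by rw [hpl]; exact hvm
    rw [← hVl]
    exact Nat.le_of_mul_le_mul_right key hp1

/-- **The certificate excludes beating.** Under the hypothesis of `sum_gain_le`, no shape list that is `SieveAdmissible M` and `U11G M` with at
least two members at an order `M` of the range (`M ≤ 1700`) beats `τ = 2371/1000`: `Σ V_i^{τ/3} ≤ Σ gainOf2371w(V_i)/10⁶ ≤ M`
(`ShapeCert.rpow_le_gain2371w`). [original] -/
theorem not_beats_of_checked {lo n : ℕ} (hall : ∀ V, 1 ≤ V → V ≤ TALin1700.Mtop → TALin1700.Checked lo n V)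
    {N M : ℕ} {a b c : Fin N → ℕ} (hN : 2 ≤ N) (hlo : lo ≤ M) (hhi : M < lo + n) (hM : M ≤ TALin1700.Mtop)
    (hS : SieveAdmissible M a b c) (hG : U11G M a b c) : ¬ Beats (2371 / 1000) M a b c := by
  have hsum := sum_gain_le hall hN hlo hhi hM hS hG
  have hV : ∀ i, a i * b i * c i ≤ 1700 := fun i => by
    have := (hS.1 i).2.2.2; simp only [shapeVol] at this; simp only [Mtop] at hM; omega
  unfold Beats
  simp only [shapeVol, not_lt]
  have hle : ∑ i, ((a i * b i * c i : ℕ) : ℝ) ^ ((2371 / 1000 : ℝ) / 3) ≤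
      ∑ i, (gainOf2371w (a i * b i * c i) : ℝ) / 1000000 :=
    Finset.sum_le_sum fun i _ => ShapeCert.rpow_le_gain2371w _ (hV i)
  rw [← Finset.sum_div] at hle
  refine hle.trans ?_
  rw [div_le_iff₀ (by norm_num)]
  have h2 : ((∑ i, gainOf2371w (a i * b i * c i) : ℕ) : ℝ) ≤ ((D * M : ℕ) : ℝ) := by exact_mod_cast hsum
  push_cast at h2
  simpa [D, mul_comm] using h2

end Summit.MatrixMultiplication.MatrixMultiplication.Theorems.TALin1700
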